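import Summits.BirchSwinnertonDyer.BirchSwinnertonDyer.Theorems.ErratumRoadFiveKatoFframeAdmissibleLogTransfer
import Summits.BirchSwinnertonDyer.BirchSwinnertonDyer.Theorems.ErratumRoadFiveKatoFframeNonvanishingOfPrint
import HarnessLib

/-!
# Crux `EulerHalfNotRamNoInertSetAtFive` (stmt-BirchSwinnertonDyer-19715), line `kato_Fframe` r5.6 — **the two research atoms
# `hVsplit` / `hVnonsplit` (= the r5.6 stubs `stub_valuationIneqSplit` / `stub_valuationIneqNonsplit`, «∀ admissible `z₀`») FOLLOW
# from their FAMILY-LEVEL forms: one valuation inequality for the bottom Kummer logarithm of the Λ-adic lift of a value-pinned Kato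
# family, with Kato's printed normalisation constants explicit** (ROUTE-INDEPENDENT module: no `Theses` import; theorems only — no
# definition, no named fact, no instance, no notation, no `sorry`)

LEAD seat `bsd-line-er5-p1` (g12), `--supports stmt-BirchSwinnertonDyer-19715`. Sequel of `ErratumRoadFiveKatoFframeAdmissibleLogTransfer`
(p768925): there, for every admissible `z₀ ∈ I.H` the bottom Kummer logarithm `t` satisfies `c₁ t = c₂ s`, `t ≠ 0 ↔ s ≠ 0` and
`v(t) = v(s) + v_p(λ/(q·R⁻_𝟙·∏_{ℓ∣A,ℓ≠p} P_ℓ(ℓ⁻¹)))` for the bottom Kummer logarithm `s` of the Λ-adic lift `y` of a value-pinned Kato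
family `(f, ι, q, Λ, c, d₁, a, A, d′; z, x)` of `W` at `p` (`λ = Ω⁺_f/Ω_W`, `R⁻_𝟙 = ratCuspFactor f true c d₁ a A d′`,
`P_ℓ(ℓ⁻¹) = eulerFactorAtOne W N ℓ`). HERE the research binders `hVsplit` / `hVnonsplit` of
`ErratumRoadFiveKatoFframeValueAtoms.integral{ExcZero,Nonsplit}Value_of_atoms` (p766845) — verbatim the registered r5.6 stubs and the
(α2) conjecture-item signatures — are DERIVED from FAMILY-LEVEL statements `hFamSplit` / `hFamNonsplit`:

  for `(W, p)` in X11b, `p ≥ 5`, `ρ̄` onto, `p` split (resp. non-split) multiplicative, a Mordell–Weil basis `P` (rank `1`), a pinned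
  cyclotomic `I`, a value-pinned Kato family with the printed guards and its lift `y ∈ I.H`, every NON-ZERO Kummer logarithm `s` of
  the bottom class `Cor_{ℚ(μ_p)/ℚ} z_{p,∅}` of `y`, and `#Ш_an = q♯ ∈ ℚ`:
  `v(s) + v_p(λ/(q·R⁻_𝟙·∏_{ℓ∣A,ℓ≠p} P_ℓ(ℓ⁻¹))) − 2·v(log_ω P̂) ≤ v_p(q♯) + v_p(∏ c_ℓ) − 2·v_p(#tors) − 1`.

So the research content of 19715 on this line is now stated on Kato's CONCRETE Euler-system class with its printed constants (Kato
Thm. 12.5 (1), Ex. 13.3, §13.9: `y = q·M·𝐳†`, `exp*`-values `q·R⁻_χ̄·∏P_ℓ(χ(ℓ)ℓ⁻¹)·L_{(p)}(W,χ̄,1)/Ω⁺_f`), no admissibility predicate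
and no `Λˣ`-ambiguity left: exactly the currency in which an integral Perrin-Riou formula at `p ∥ N` would be proved.

CONTENTS. §1 `valuationIneqSplit_of_family`, `valuationIneqNonsplit_of_family` (conclusions = `hVsplit` / `hVnonsplit` VERBATIM); the
proof: GZK-free — the stub's own `h1 : rank = 1` gives positive rank, hence a Kummer logarithm `s` of the bottom class of `y`
(`ErratumRoadFiveKatoFframeValueAtoms.exists_hasLocPKummerLog_bottomClass`), `s ≠ 0` and the valuation shift by p768925 ★, then the
family-level inequality. §2 `missingUpperBoundAt_of_printedFacts_of_familyInequalities`: the Euler half `Typed.MissingUpperBoundAt W p` on ALL of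
X11b ∩ {p ≥ 5, ρ̄ onto} ⟸ SEVEN named facts {GZK, Kato 12.5 (4) realisability, F1′, H2Xʳ, GZ86 I.(7.3), Venerucci 2016, BDV 2022} + the two
FAMILY-LEVEL inequalities (p768140 ★ fed with §1); the crux-named corollary lives in `ErratumRoadFiveKatoFframeClosureOfFamily` (theses-cone hygiene).

HONEST FRAMING: CONDITIONAL reductions (family-level binders ⟹ admissible-level stubs); nothing about the values is asserted; closes
nothing; credits no registered stub by itself (the registered stubs would be closed BY NAME as `valuationIneq{Split,Nonsplit}_of_family h`
once a family-level `h` is a theorem). No summit statement is proved; BSD is proved for no curve.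

References: [Kato2004Asterisque] Thm. 12.5 (1) (pp. 221–222), Ex. 13.3 (p. 225), §13.9 and Lemma 13.10 (1) (pp. 229–230);
[PerrinRiou1993AIF] §3.3; [Venerucci2016] Thm. A; [BertoliniDarmonVenerucci2022] Thm. A; [BurungaleSkinnerTianWan2024] Conj. 1.12,
Thm. 1.13 (the `p ∤ 2N` integral form — NOT `p ∥ N`); tree: `ErratumRoadFiveKatoFframeAdmissibleLogTransfer` (p768925),
`ErratumRoadFiveKatoFframeValueAtoms` (p766845).
-/

-- the summit and its single problem are both named `BirchSwinnertonDyer` (registry layout D-0017)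
set_option linter.dupNamespace false
set_option autoImplicit false

noncomputable section

open scoped BigOperators NumberField TensorProduct Classical
open Field IsDedekindDomain NumberField CongruenceSubgroup ValuativeRel WeierstrassCurve
open Literature.NumberTheory.GaloisRepresentations
open Literature.NumberTheory.GaloisRepresentations.PeriodRingData
open Literature.NumberTheory.GaloisRepresentations.IsNonarchimedeanLocalField
open Literature.NumberTheory.PAdicHodge
open Literature.NumberTheory.EllipticCurves Literature.NumberTheory.EllipticCurves.ModularForms
open Literature.NumberTheory.EllipticCurves.Kato2004 Literature.NumberTheory.EllipticCurves.Kato2004.EulerSystemValues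
open Literature.NumberTheory.EllipticCurves.Rank1Residual Literature.NumberTheory.EllipticCurves.Rank1Residual.Typed
open Literature.NumberTheory.AdelicBaseChange Literature.NumberTheory.Automorphic
open Summit.BirchSwinnertonDyer.Rank1Residual Summit.BirchSwinnertonDyer.Rank1Residual.Additive

namespace Summit.BirchSwinnertonDyer.BirchSwinnertonDyer.Theorems.ErratumRoadFiveKatoFframeValueAtomsOfFamily

/-! ## §1 The two atoms from their family-level forms -/

/-- **`hVsplit` (= r5.6 `stub_valuationIneqSplit`, «∀ admissible `z₀`») from its FAMILY-LEVEL form**: at a SPLIT multiplicative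
`p ≥ 5` with `ρ̄` onto on X11b, if for every value-pinned Kato family of `W` at `p` (newform `f`, datum `(ι, q, Λ)`, parameters
`(c, d₁, a, A, d′)` with the printed guards, family `(z, x)`, lift `y ∈ I.H`, period ratio `λ`) every non-zero Kummer logarithm `s` of the
bottom class of `y` satisfies `v(s) + v_p(λ/(q·R⁻_𝟙·∏_{ℓ∣A,ℓ≠p}P_ℓ(ℓ⁻¹))) − 2·v(log_ω P̂) ≤ v_p(#Ш_an) + v_p(∏c_ℓ) − 2·v_p(#tors) − 1`,
then the same inequality holds with `v(t)` for every Kummer logarithm `t ≠ 0` of the bottom class of every ADMISSIBLE `z₀`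
(p768925 ★: `v(t) = v(s) + shift`). CONDITIONAL reduction; closes nothing by itself.
[cite: Kato2004Asterisque, Thm. 12.5 (1) (pp. 221–222), Ex. 13.3 (p. 225), Lemma 13.10 (1) (p. 230)] [cite: PerrinRiou1993AIF, §3.3] -/
theorem valuationIneqSplit_of_family
    (hFamSplit : ∀ (W : WeierstrassCurve ℚ) [W.IsElliptic] [W.IsGloballyMinimal] (p : ℕ) [Fact p.Prime]
      [ContinuousSMul ℤ_[p] (W.tateModule p)] [Module.Free ℤ_[p] (W.tateModule p)] [Module.Finite ℤ_[p] (W.tateModule p)],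
      ClassX11b W p → 5 ≤ p → Surj W p → W.HasSplitMultiplicativeReductionAtPrime p →
      ∀ (h1 : W.mordellWeilRank = 1) (P : Fin W.mordellWeilRank → W.toAffine.Point),
        W.IsMordellWeilBasis P →
      ∀ (K : ZpExtension ℚ p) (hK : K.IsCyclotomic) (γ : absoluteGaloisGroup ℚ)
        (I : IwasawaH1Data W p K γ), K.IsTopGenerator γ →
      ∀ (hp : p ≠ 2) (N : ℕ) [NeZero N] (f : CuspForm (Gamma0 N) 2), IsNewformOf W f →
      ∀ (ι : (n : ℕ) → (CyclotomicField n ℚ →+* ℂ)) (q : ℚ)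
        (Λ : ∀ (k : ℕ) (r : Finset (HeightOneSpectrum (𝓞 ℚ))),
          H1 (tateRep W p) (cycSubgroup p k r) →ₗ[ℤ_[p]] ℚ_[p] ⊗[ℚ] CyclotomicField (cycLevel p k r) ℚ)
        (c d₁ a : ℤ) (A : ℕ) (d' : ℤ)
        (z : ∀ (k : ℕ) (r : (cyclotomicLevelsRat p (badPlaces c d₁ A N)).Ideals),
          H1 (tateRep W p) ((cyclotomicLevelsRat p (badPlaces c d₁ A N)).level k r.1))
        (x : ∀ (k : ℕ) (r : (cyclotomicLevelsRat p (badPlaces c d₁ A N)).Ideals),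
          CyclotomicField (cycLevel p k r.1) ℚ)
        (y : I.H) (perRatio : ℚ),
        q ≠ 0 → ZetaBody W p f ι ((q : ℚ) : ℝ) Λ c d₁ a A z x →
        (∀ n : ℕ, I.proj n y =
          levelToLayer W p hK hp (badPlaces c d₁ A N) n
            (z (n + 1) (cyclotomicLevelsRat p (badPlaces c d₁ A N)).idealOne)) →
        0 < A → Int.gcd c (6 * p * A) = 1 → Int.gcd d₁ (6 * p * N) = 1 → (d₁ : ℤ) * d' ≡ 1 [ZMOD (A : ℤ)] →
        ratCuspFactor f true c d₁ a A d' ≠ 0 → perRatio ≠ 0 →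
        plusPeriod f = ((perRatio : ℚ) : ℝ) * W.realPeriodRat →
      ∀ s : ℚ_[p], HasLocPKummerLog W p (layerZeroToTop W p K (I.proj 0 y)) s → s ≠ 0 →
      ∀ qSha : ℚ, shaAn W = (qSha : ℂ) →
        s.valuation +
              padicValRat p (perRatio /
                (q * ratCuspFactor f true c d₁ a A d' * ∏ ℓ ∈ A.primeFactors.erase p, eulerFactorAtOne W N ℓ)) -
            2 * (padicLogLocal W p (WeierstrassCurve.Affine.Point.map (Algebra.ofId ℚ ℚ_[p]) (P (Fin.cast h1.symm 0)))).valuation ≤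
          padicValRat p qSha + padicValNat p W.tamagawaProduct - 2 * padicValNat p W.torsionOrder - 1) :
    ∀ (W : WeierstrassCurve ℚ) [W.IsElliptic] [W.IsGloballyMinimal] (p : ℕ) [Fact p.Prime]
      [ContinuousSMul ℤ_[p] (W.tateModule p)],
      ClassX11b W p → 5 ≤ p → Surj W p → W.HasSplitMultiplicativeReductionAtPrime p →
      ∀ (h1 : W.mordellWeilRank = 1) (P : Fin W.mordellWeilRank → W.toAffine.Point),
        W.IsMordellWeilBasis P →
      ∀ (K : ZpExtension ℚ p) (hK : K.IsCyclotomic) (γ : absoluteGaloisGroup ℚ)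
        (I : IwasawaH1Data W p K γ) (z₀ : I.H), K.IsTopGenerator γ → IsAdmissibleZetaClass W p K hK I z₀ →
      ∀ t : ℚ_[p], HasLocPKummerLog W p (layerZeroToTop W p K (I.proj 0 z₀)) t → t ≠ 0 →
      ∀ q : ℚ, shaAn W = (q : ℂ) →
        t.valuation -
            2 * (padicLogLocal W p (WeierstrassCurve.Affine.Point.map (Algebra.ofId ℚ ℚ_[p]) (P (Fin.cast h1.symm 0)))).valuation ≤
          padicValRat p q + padicValNat p W.tamagawaProduct - 2 * padicValNat p W.torsionOrder - 1 := by
  intro W _ _ p _ _ hX h5 hSurj hsplit h1 P hP K hK γ I z₀ hγ hz t ht ht0 qSha hqSha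
  haveI : Module.Free ℤ_[p] (W.tateModule p) := module_free_tateModule_holds W p
  haveI : Module.Finite ℤ_[p] (W.tateModule p) := module_finite_tateModule_holds W p
  obtain ⟨hp, N, hN, f, hf, ι, q, Λ, c, d₁, a, A, d', z, x, y, perRatio, c₁, c₂, hq, hzeta, hy, hA, hc, hd, hdd',
    hR, hper0, hper, -, -, -, htr⟩ :=
    ErratumRoadFiveKatoFframeAdmissibleLogTransfer.exists_family_kummerLog_transfer_of_isAdmissibleZetaClass W p K hK I z₀ hz
  -- rank one ⇒ the bottom class of the lift `y` has a Kummer logarithm `s`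
  obtain ⟨s, hs⟩ := ErratumRoadFiveKatoFframeValueAtoms.exists_hasLocPKummerLog_bottomClass W p (by omega) K I y
  obtain ⟨-, hiff, hval⟩ := htr t s ht hs
  have hs0 : s ≠ 0 := hiff.mp ht0
  have hfam := hFamSplit W p hX h5 hSurj hsplit h1 P hP K hK γ I hγ hp N f hf ι q Λ c d₁ a A d' z x y perRatio hq hzeta hy
    hA hc hd hdd' hR hper0 hper s hs hs0 qSha hqSha
  rw [hval ht0]
  exact hfam

/-- **`hVnonsplit` (= r5.6 `stub_valuationIneqNonsplit`, «∀ admissible `z₀`») from its FAMILY-LEVEL form** — as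
`valuationIneqSplit_of_family` at a NON-SPLIT multiplicative `p ≥ 5`. CONDITIONAL reduction; closes nothing by itself.
[cite: Kato2004Asterisque, Thm. 12.5 (1) (pp. 221–222), Ex. 13.3 (p. 225), Lemma 13.10 (1) (p. 230)] [cite: PerrinRiou1993AIF, §3.3] -/
theorem valuationIneqNonsplit_of_family
    (hFamNonsplit : ∀ (W : WeierstrassCurve ℚ) [W.IsElliptic] [W.IsGloballyMinimal] (p : ℕ) [Fact p.Prime]
      [ContinuousSMul ℤ_[p] (W.tateModule p)] [Module.Free ℤ_[p] (W.tateModule p)] [Module.Finite ℤ_[p] (W.tateModule p)],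
      ClassX11b W p → 5 ≤ p → Surj W p → ¬ W.HasSplitMultiplicativeReductionAtPrime p →
      ∀ (h1 : W.mordellWeilRank = 1) (P : Fin W.mordellWeilRank → W.toAffine.Point),
        W.IsMordellWeilBasis P →
      ∀ (K : ZpExtension ℚ p) (hK : K.IsCyclotomic) (γ : absoluteGaloisGroup ℚ)
        (I : IwasawaH1Data W p K γ), K.IsTopGenerator γ →
      ∀ (hp : p ≠ 2) (N : ℕ) [NeZero N] (f : CuspForm (Gamma0 N) 2), IsNewformOf W f →
      ∀ (ι : (n : ℕ) → (CyclotomicField n ℚ →+* ℂ)) (q : ℚ)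
        (Λ : ∀ (k : ℕ) (r : Finset (HeightOneSpectrum (𝓞 ℚ))),
          H1 (tateRep W p) (cycSubgroup p k r) →ₗ[ℤ_[p]] ℚ_[p] ⊗[ℚ] CyclotomicField (cycLevel p k r) ℚ)
        (c d₁ a : ℤ) (A : ℕ) (d' : ℤ)
        (z : ∀ (k : ℕ) (r : (cyclotomicLevelsRat p (badPlaces c d₁ A N)).Ideals),
          H1 (tateRep W p) ((cyclotomicLevelsRat p (badPlaces c d₁ A N)).level k r.1))
        (x : ∀ (k : ℕ) (r : (cyclotomicLevelsRat p (badPlaces c d₁ A N)).Ideals),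
          CyclotomicField (cycLevel p k r.1) ℚ)
        (y : I.H) (perRatio : ℚ),
        q ≠ 0 → ZetaBody W p f ι ((q : ℚ) : ℝ) Λ c d₁ a A z x →
        (∀ n : ℕ, I.proj n y =
          levelToLayer W p hK hp (badPlaces c d₁ A N) n
            (z (n + 1) (cyclotomicLevelsRat p (badPlaces c d₁ A N)).idealOne)) →
        0 < A → Int.gcd c (6 * p * A) = 1 → Int.gcd d₁ (6 * p * N) = 1 → (d₁ : ℤ) * d' ≡ 1 [ZMOD (A : ℤ)] →
        ratCuspFactor f true c d₁ a A d' ≠ 0 → perRatio ≠ 0 →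
        plusPeriod f = ((perRatio : ℚ) : ℝ) * W.realPeriodRat →
      ∀ s : ℚ_[p], HasLocPKummerLog W p (layerZeroToTop W p K (I.proj 0 y)) s → s ≠ 0 →
      ∀ qSha : ℚ, shaAn W = (qSha : ℂ) →
        s.valuation +
              padicValRat p (perRatio /
                (q * ratCuspFactor f true c d₁ a A d' * ∏ ℓ ∈ A.primeFactors.erase p, eulerFactorAtOne W N ℓ)) -
            2 * (padicLogLocal W p (WeierstrassCurve.Affine.Point.map (Algebra.ofId ℚ ℚ_[p]) (P (Fin.cast h1.symm 0)))).valuation ≤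
          padicValRat p qSha + padicValNat p W.tamagawaProduct - 2 * padicValNat p W.torsionOrder - 1) :
    ∀ (W : WeierstrassCurve ℚ) [W.IsElliptic] [W.IsGloballyMinimal] (p : ℕ) [Fact p.Prime]
      [ContinuousSMul ℤ_[p] (W.tateModule p)],
      ClassX11b W p → 5 ≤ p → Surj W p → ¬ W.HasSplitMultiplicativeReductionAtPrime p →
      ∀ (h1 : W.mordellWeilRank = 1) (P : Fin W.mordellWeilRank → W.toAffine.Point),
        W.IsMordellWeilBasis P →
      ∀ (K : ZpExtension ℚ p) (hK : K.IsCyclotomic) (γ : absoluteGaloisGroup ℚ)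
        (I : IwasawaH1Data W p K γ) (z₀ : I.H), K.IsTopGenerator γ → IsAdmissibleZetaClass W p K hK I z₀ →
      ∀ t : ℚ_[p], HasLocPKummerLog W p (layerZeroToTop W p K (I.proj 0 z₀)) t → t ≠ 0 →
      ∀ q : ℚ, shaAn W = (q : ℂ) →
        t.valuation -
            2 * (padicLogLocal W p (WeierstrassCurve.Affine.Point.map (Algebra.ofId ℚ ℚ_[p]) (P (Fin.cast h1.symm 0)))).valuation ≤
          padicValRat p q + padicValNat p W.tamagawaProduct - 2 * padicValNat p W.torsionOrder - 1 := by
  intro W _ _ p _ _ hX h5 hSurj hns h1 P hP K hK γ I z₀ hγ hz t ht ht0 qSha hqSha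
  haveI : Module.Free ℤ_[p] (W.tateModule p) := module_free_tateModule_holds W p
  haveI : Module.Finite ℤ_[p] (W.tateModule p) := module_finite_tateModule_holds W p
  obtain ⟨hp, N, hN, f, hf, ι, q, Λ, c, d₁, a, A, d', z, x, y, perRatio, c₁, c₂, hq, hzeta, hy, hA, hc, hd, hdd',
    hR, hper0, hper, -, -, -, htr⟩ :=
    ErratumRoadFiveKatoFframeAdmissibleLogTransfer.exists_family_kummerLog_transfer_of_isAdmissibleZetaClass W p K hK I z₀ hz
  obtain ⟨s, hs⟩ := ErratumRoadFiveKatoFframeValueAtoms.exists_hasLocPKummerLog_bottomClass W p (by omega) K I y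
  obtain ⟨-, hiff, hval⟩ := htr t s ht hs
  have hs0 : s ≠ 0 := hiff.mp ht0
  have hfam := hFamNonsplit W p hX h5 hSurj hns h1 P hP K hK γ I hγ hp N f hf ι q Λ c d₁ a A d' z x y perRatio hq hzeta hy
    hA hc hd hdd' hR hper0 hper s hs hs0 qSha hqSha
  rw [hval ht0]
  exact hfam


/-! ## §2 The Euler half on X11b ∩ {p ≥ 5, ρ̄ onto} from seven named facts + the two FAMILY-LEVEL inequalities -/

/-- **`Typed.MissingUpperBoundAt W p` on ALL of X11b ∩ {p ≥ 5, ρ̄ onto} from the SEVEN named facts {GZK, Kato 12.5 (4) realisability,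
F1′, H2Xʳ, GZ86 I.(7.3), Venerucci 2016, BDV 2022} and the two FAMILY-LEVEL valuation inequalities `hFamSplit` / `hFamNonsplit`**
(research; stated on the bottom class of the Λ-adic lift of a value-pinned Kato family with Kato's printed constants — no admissibility
predicate, no `Λˣ`-ambiguity): p768140's `missingUpperBoundAt_of_printedFacts_of_inequalities` fed with §1. CONDITIONAL; closes nothing.
[cite: Kato2004Asterisque, Thm. 12.4 (3), Thm. 12.5 (4) (pp. 221–222), (14.9.3), (14.14.2)] [cite: Venerucci2016, Thm. A and Thm. B]
[cite: BertoliniDarmonVenerucci2022, Thm. A] [cite: GrossZagier1986, Thm. I.(7.3)] [cite: Darmon2004, Thm. 3.22] -/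
theorem missingUpperBoundAt_of_printedFacts_of_familyInequalities
    (hGZK : rank_eq_analyticRank_of_analyticRank_le_one)
    (hReal : exists_isAdmissibleZetaClass_of_imageContainsSL2)
    (hF1 : lengthAt_fineSelmerDual_le_of_isAdmissibleZetaClass)
    (hH2X : exists_iwasawaH2Data_fineSelmerDual_embedding_countRankFree)
    (hGZ : GrossZagier1986_thm_I_7_3)
    (hV : Venerucci2016_kummerLog_bottomLayer_ne_zero_split)
    (hB : BertoliniDarmonVenerucci2022_kummerLog_bottomLayer_ne_zero)
    (hFamSplit : ∀ (W : WeierstrassCurve ℚ) [W.IsElliptic] [W.IsGloballyMinimal] (p : ℕ) [Fact p.Prime]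
      [ContinuousSMul ℤ_[p] (W.tateModule p)] [Module.Free ℤ_[p] (W.tateModule p)] [Module.Finite ℤ_[p] (W.tateModule p)],
      ClassX11b W p → 5 ≤ p → Surj W p → W.HasSplitMultiplicativeReductionAtPrime p →
      ∀ (h1 : W.mordellWeilRank = 1) (P : Fin W.mordellWeilRank → W.toAffine.Point),
        W.IsMordellWeilBasis P →
      ∀ (K : ZpExtension ℚ p) (hK : K.IsCyclotomic) (γ : absoluteGaloisGroup ℚ)
        (I : IwasawaH1Data W p K γ), K.IsTopGenerator γ →
      ∀ (hp : p ≠ 2) (N : ℕ) [NeZero N] (f : CuspForm (Gamma0 N) 2), IsNewformOf W f →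
      ∀ (ι : (n : ℕ) → (CyclotomicField n ℚ →+* ℂ)) (q : ℚ)
        (Λ : ∀ (k : ℕ) (r : Finset (HeightOneSpectrum (𝓞 ℚ))),
          H1 (tateRep W p) (cycSubgroup p k r) →ₗ[ℤ_[p]] ℚ_[p] ⊗[ℚ] CyclotomicField (cycLevel p k r) ℚ)
        (c d₁ a : ℤ) (A : ℕ) (d' : ℤ)
        (z : ∀ (k : ℕ) (r : (cyclotomicLevelsRat p (badPlaces c d₁ A N)).Ideals),
          H1 (tateRep W p) ((cyclotomicLevelsRat p (badPlaces c d₁ A N)).level k r.1))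
        (x : ∀ (k : ℕ) (r : (cyclotomicLevelsRat p (badPlaces c d₁ A N)).Ideals),
          CyclotomicField (cycLevel p k r.1) ℚ)
        (y : I.H) (perRatio : ℚ),
        q ≠ 0 → ZetaBody W p f ι ((q : ℚ) : ℝ) Λ c d₁ a A z x →
        (∀ n : ℕ, I.proj n y =
          levelToLayer W p hK hp (badPlaces c d₁ A N) n
            (z (n + 1) (cyclotomicLevelsRat p (badPlaces c d₁ A N)).idealOne)) →
        0 < A → Int.gcd c (6 * p * A) = 1 → Int.gcd d₁ (6 * p * N) = 1 → (d₁ : ℤ) * d' ≡ 1 [ZMOD (A : ℤ)] →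
        ratCuspFactor f true c d₁ a A d' ≠ 0 → perRatio ≠ 0 →
        plusPeriod f = ((perRatio : ℚ) : ℝ) * W.realPeriodRat →
      ∀ s : ℚ_[p], HasLocPKummerLog W p (layerZeroToTop W p K (I.proj 0 y)) s → s ≠ 0 →
      ∀ qSha : ℚ, shaAn W = (qSha : ℂ) →
        s.valuation +
              padicValRat p (perRatio /
                (q * ratCuspFactor f true c d₁ a A d' * ∏ ℓ ∈ A.primeFactors.erase p, eulerFactorAtOne W N ℓ)) -
            2 * (padicLogLocal W p (WeierstrassCurve.Affine.Point.map (Algebra.ofId ℚ ℚ_[p]) (P (Fin.cast h1.symm 0)))).valuation ≤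
          padicValRat p qSha + padicValNat p W.tamagawaProduct - 2 * padicValNat p W.torsionOrder - 1)
    (hFamNonsplit : ∀ (W : WeierstrassCurve ℚ) [W.IsElliptic] [W.IsGloballyMinimal] (p : ℕ) [Fact p.Prime]
      [ContinuousSMul ℤ_[p] (W.tateModule p)] [Module.Free ℤ_[p] (W.tateModule p)] [Module.Finite ℤ_[p] (W.tateModule p)],
      ClassX11b W p → 5 ≤ p → Surj W p → ¬ W.HasSplitMultiplicativeReductionAtPrime p →
      ∀ (h1 : W.mordellWeilRank = 1) (P : Fin W.mordellWeilRank → W.toAffine.Point),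
        W.IsMordellWeilBasis P →
      ∀ (K : ZpExtension ℚ p) (hK : K.IsCyclotomic) (γ : absoluteGaloisGroup ℚ)
        (I : IwasawaH1Data W p K γ), K.IsTopGenerator γ →
      ∀ (hp : p ≠ 2) (N : ℕ) [NeZero N] (f : CuspForm (Gamma0 N) 2), IsNewformOf W f →
      ∀ (ι : (n : ℕ) → (CyclotomicField n ℚ →+* ℂ)) (q : ℚ)
        (Λ : ∀ (k : ℕ) (r : Finset (HeightOneSpectrum (𝓞 ℚ))),
          H1 (tateRep W p) (cycSubgroup p k r) →ₗ[ℤ_[p]] ℚ_[p] ⊗[ℚ] CyclotomicField (cycLevel p k r) ℚ)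
        (c d₁ a : ℤ) (A : ℕ) (d' : ℤ)
        (z : ∀ (k : ℕ) (r : (cyclotomicLevelsRat p (badPlaces c d₁ A N)).Ideals),
          H1 (tateRep W p) ((cyclotomicLevelsRat p (badPlaces c d₁ A N)).level k r.1))
        (x : ∀ (k : ℕ) (r : (cyclotomicLevelsRat p (badPlaces c d₁ A N)).Ideals),
          CyclotomicField (cycLevel p k r.1) ℚ)
        (y : I.H) (perRatio : ℚ),
        q ≠ 0 → ZetaBody W p f ι ((q : ℚ) : ℝ) Λ c d₁ a A z x →
        (∀ n : ℕ, I.proj n y =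
          levelToLayer W p hK hp (badPlaces c d₁ A N) n
            (z (n + 1) (cyclotomicLevelsRat p (badPlaces c d₁ A N)).idealOne)) →
        0 < A → Int.gcd c (6 * p * A) = 1 → Int.gcd d₁ (6 * p * N) = 1 → (d₁ : ℤ) * d' ≡ 1 [ZMOD (A : ℤ)] →
        ratCuspFactor f true c d₁ a A d' ≠ 0 → perRatio ≠ 0 →
        plusPeriod f = ((perRatio : ℚ) : ℝ) * W.realPeriodRat →
      ∀ s : ℚ_[p], HasLocPKummerLog W p (layerZeroToTop W p K (I.proj 0 y)) s → s ≠ 0 →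
      ∀ qSha : ℚ, shaAn W = (qSha : ℂ) →
        s.valuation +
              padicValRat p (perRatio /
                (q * ratCuspFactor f true c d₁ a A d' * ∏ ℓ ∈ A.primeFactors.erase p, eulerFactorAtOne W N ℓ)) -
            2 * (padicLogLocal W p (WeierstrassCurve.Affine.Point.map (Algebra.ofId ℚ ℚ_[p]) (P (Fin.cast h1.symm 0)))).valuation ≤
          padicValRat p qSha + padicValNat p W.tamagawaProduct - 2 * padicValNat p W.torsionOrder - 1) :
    ∀ (W : WeierstrassCurve ℚ) [W.IsElliptic] [W.IsGloballyMinimal] (p : ℕ) [Fact p.Prime],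
      ClassX11b W p → 5 ≤ p → Surj W p → MissingUpperBoundAt W p :=
  ErratumRoadFiveKatoFframeNonvanishingOfPrint.missingUpperBoundAt_of_printedFacts_of_inequalities hGZK hReal hF1 hH2X hGZ hV hB
    (valuationIneqSplit_of_family hFamSplit) (valuationIneqNonsplit_of_family hFamNonsplit)

end Summit.BirchSwinnertonDyer.BirchSwinnertonDyer.Theorems.ErratumRoadFiveKatoFframeValueAtomsOfFamily

end
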